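import Summits.BirchSwinnertonDyer.BirchSwinnertonDyer.Theorems.ResidualThetaTransportAtTwoInvariantRestriction
import Summits.BirchSwinnertonDyer.BirchSwinnertonDyer.Theorems.ResidualThetaTransportAtTwoSemilinearH1
import Summits.BirchSwinnertonDyer.BirchSwinnertonDyer.Theorems.ResidualThetaTransportAtTwoResidualEvenSubgroup
import Literature.NumberTheory.EllipticCurves.ZpExtensionGaloisTwistLocalLiftProofs
import HarnessLib

/-!
# The residual transfer count on the habitat: `#X = (#res⁻¹(X))²` for every `ω`-, `c`-stable subgroup `X ≤ H¹(Γ_{ℚ_∞} ∩ N, W[2])`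
# — «`dim_{𝔽₂} R(W[2]/ℚ_∞) = dim_{𝔽₄} R(W[2]/K_∞)`» assembled from the global transfer package (p618869, p620184, p620713)
# (lead prover bsd-wall-rtt-p2 g10; `--supports stmt-BirchSwinnertonDyer-26074`; route-independent, closes nothing)

HONEST FRAMING. THEOREMS ONLY (no definition, no named fact, no instance, no `sorry`); nothing about the crux's local conditions is
asserted — the subgroup `X` is ARBITRARY subject to two stability hypotheses; BSD is not proved by any of this. No route (`Theses`) file.

SETTING (crux `(R≥)ᵖ`, item stmt-BirchSwinnertonDyer-26074; memo `Cruxes/ResidualThetaCountLowerPureAtTwo/LAMBDA-INEQ-g10.md` §5).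
`W/ℚ` on the habitat (`GoodSS W 2`, `Δ_W < 0`), `κ` ANY `ℤ₂`-extension, `N ≤ Γ_ℚ` the even subgroup of `W[2]`
(`σ ∈ N ↔ sign ρ̄(σ) = 1`; `= Γ_{ℚ(√Δ_W)}`), open; `c = res τ_∞` a complex conjugation (`τ_∞ ≠ 1` in `Gal(ℚ̄_w/ℚ_w)`), `τ₀ ∈ Γ_ℚ` even
with `ρ̄(τ₀) ≠ 1` (exists inside `Γ_{ℚ_∞}`: `exists_even_permGal_ne_one_mem_kerSubgroup`); `V = (W[2^∞])[2]`, `e = τ₀•` on `V`,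
`ω = H¹(e)`, `res : H¹(Γ_{ℚ_∞}, V) → H¹(Γ_{ℚ_∞} ∩ N, V)`.
* `conjH1_resOfLe_kerSubgroup_inf_eq` — `conj_g (res x) = res x` for `g ∈ Γ_{ℚ_∞}`;
* `forall_conjH1_eq_of_conjH1_resGal_eq` — a class of `H¹(Γ_{ℚ_∞} ∩ N, V)` fixed by `conj_c` is fixed by all of `Γ_{ℚ_∞}` (`c` is odd,
  `[Γ_ℚ : N] = 2`, `Γ_{ℚ_∞} ∩ N` acts trivially);
* **`natCard_eq_sq_natCard_comap_resOfLe`** — for every additive subgroup `X ≤ H¹(Γ_{ℚ_∞} ∩ N, V)` stable under `ω` and `conj_c`: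
  `Nat.card X = (Nat.card (X.comap res))²`.
So a line proving `(R≥)ᵖ` through the CM side needs exactly: its `K_∞`-side residual Selmer subgroup `X` is `ω`- and `c`-stable, and
`res⁻¹(X)` is the crux's counted set (unramified clause: p619843 + `inertia_le_of_even_of_not_mem`; archimedean clause: none, p617001;
clause at `2`: line-specific).

References: [SerreLocalFields1979] VII.§6, X.§1; [SilvermanAEC2009] III.§7; [GreenbergVatsal2000] §2.
-/

set_option autoImplicit false
-- D-0017: single-problem summit, so `Summit.BirchSwinnertonDyer.BirchSwinnertonDyer.…` repeats a namespace BY DESIGN.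
set_option linter.dupNamespace false

noncomputable section

open scoped Classical AddSubgroup

open Equiv WeierstrassCurve NumberField Field Literature.NumberTheory.EllipticCurves
  Literature.NumberTheory.EllipticCurves.DokchitserDokchitser2012 Literature.NumberTheory.GaloisRepresentations

namespace Summit.BirchSwinnertonDyer.BirchSwinnertonDyer.Theorems.ResidualLayer

variable (W : WeierstrassCurve ℚ) [W.IsElliptic] [W.IsGloballyMinimal] (h2 : (2 : ℚ) ≠ 0)

omit [W.IsElliptic] [W.IsGloballyMinimal] in
/-- `conj_g ∘ res = res` on `H¹(Γ_{ℚ_∞}, V)` for `g ∈ Γ_{ℚ_∞}` (`conj_g = id` at level `Γ_{ℚ_∞}`, `resOfLe_comp_conjH1`).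
[cite: NeukirchSchmidtWingberg2008, (1.6.3)] -/
theorem conjH1_resOfLe_kerSubgroup_inf_eq (κ : ZpExtension ℚ 2) (N : Subgroup (absoluteGaloisGroup ℚ)) [N.Normal]
    (g : κ.kerSubgroup) (x : subgroupH1 κ.kerSubgroup ↥((↥(W.geomPrimaryTorsion 2))[(2 : ℤ)])) :
    conjH1 (κ.kerSubgroup ⊓ N) ↥((↥(W.geomPrimaryTorsion 2))[(2 : ℤ)]) (g : absoluteGaloisGroup ℚ)
        (resOfLe ↥((↥(W.geomPrimaryTorsion 2))[(2 : ℤ)]) (inf_le_left : κ.kerSubgroup ⊓ N ≤ κ.kerSubgroup) x) =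
      resOfLe ↥((↥(W.geomPrimaryTorsion 2))[(2 : ℤ)]) (inf_le_left : κ.kerSubgroup ⊓ N ≤ κ.kerSubgroup) x := by
  rw [← AddMonoidHom.comp_apply, ← resOfLe_comp_conjH1_holds, AddMonoidHom.comp_apply,
    conjH1_of_mem_holds κ.kerSubgroup _ g.2, AddMonoidHom.id_apply]

omit [W.IsGloballyMinimal] in
/-- **A class of `H¹(Γ_{ℚ_∞} ∩ N, V)` fixed by `conj_c` is fixed by `conj_g` for every `g ∈ Γ_{ℚ_∞}`** (`c = res τ_∞` a complex
conjugation, `Δ_W < 0` so `c ∉ N`, `[Γ_ℚ : N] = 2`: `Γ_{ℚ_∞} = (Γ_{ℚ_∞} ∩ N) ∪ (Γ_{ℚ_∞} ∩ N)·c`, and `Γ_{ℚ_∞} ∩ N` acts trivially).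
[cite: NeukirchSchmidtWingberg2008, (1.6.3)] -/
theorem forall_conjH1_eq_of_conjH1_resGal_eq (hΔ : W.Δ < 0) (κ : ZpExtension ℚ 2)
    (N : Subgroup (absoluteGaloisGroup ℚ)) [N.Normal] (hN : ∀ σ, σ ∈ N ↔ Perm.sign (permGal W h2 σ) = 1)
    (w : InfinitePlace ℚ) {τ : absoluteGaloisGroup w.Completion} (hτ : τ ≠ 1)
    {y : subgroupH1 (κ.kerSubgroup ⊓ N) ↥((↥(W.geomPrimaryTorsion 2))[(2 : ℤ)])}
    (hy : conjH1 (κ.kerSubgroup ⊓ N) ↥((↥(W.geomPrimaryTorsion 2))[(2 : ℤ)]) (resGal (K := ℚ) w.Completion τ) y = y)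
    (g : κ.kerSubgroup) :
    conjH1 (κ.kerSubgroup ⊓ N) ↥((↥(W.geomPrimaryTorsion 2))[(2 : ℤ)]) (g : absoluteGaloisGroup ℚ) y = y := by
  set c := resGal (K := ℚ) w.Completion τ with hc
  have hcN : c ∉ N := by
    rw [hN, sign_permGal_resGal_eq_neg_one_of_Δ_neg W h2 hΔ w hτ]; decide
  have hcκ : c ∈ κ.kerSubgroup := ZpExtension.resGal_mem_kerSubgroup_of_infinitePlace κ w τ
  have hidx := index_eq_two_of_Δ_neg W h2 N hN hΔ
  by_cases hgN : (g : absoluteGaloisGroup ℚ) ∈ N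
  · rw [conjH1_of_mem_holds (κ.kerSubgroup ⊓ N) _ (Subgroup.mem_inf.mpr ⟨g.2, hgN⟩), AddMonoidHom.id_apply]
  · -- `g = (g c⁻¹) c` with `g c⁻¹ ∈ Γ_{ℚ_∞} ∩ N`
    have hgc : (g : absoluteGaloisGroup ℚ) * c⁻¹ ∈ κ.kerSubgroup ⊓ N := by
      refine Subgroup.mem_inf.mpr ⟨mul_mem g.2 (inv_mem hcκ), ?_⟩
      rw [Subgroup.mul_mem_iff_of_index_two hidx, inv_mem_iff]
      exact iff_of_false hgN hcN
    have e : (g : absoluteGaloisGroup ℚ) = ((g : absoluteGaloisGroup ℚ) * c⁻¹) * c := by rw [inv_mul_cancel_right]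
    rw [e, conjH1_mul_holds (κ.kerSubgroup ⊓ N) _, AddMonoidHom.comp_apply, hy,
      conjH1_of_mem_holds (κ.kerSubgroup ⊓ N) _ hgc, AddMonoidHom.id_apply]

/-- **The residual transfer count `#X = (#res⁻¹(X))²`.** On the habitat (`GoodSS W 2`, `Δ_W < 0`), for any `ℤ₂`-extension `κ`, the
open even subgroup `N`, a complex conjugation `c = res τ_∞` and an even `τ₀` with `ρ̄(τ₀) ≠ 1`: every additive subgroup
`X ≤ H¹(Γ_{ℚ_∞} ∩ N, (W[2^∞])[2])` stable under `ω = H¹(τ₀•)` and under `conj_c` satisfies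
`Nat.card X = (Nat.card (X.comap res))²`, `res : H¹(Γ_{ℚ_∞}, ·) → H¹(Γ_{ℚ_∞} ∩ N, ·)`. Assembly: `#X = (#X^{conj_c})²`
(`natCard_eq_sq_natCard_fixed_of_stable`, p620184, its four inputs from `…ResidualEvenSubgroup`, p620713) and `res` is a bijection from
`res⁻¹(X)` onto `X^{conj_c} = X^{Γ_{ℚ_∞}}` (`resOfLe_kerSubgroup_inf_injective`, `exists_resOfLe_kerSubgroup_inf_eq_of_forall_conjH1_eq`,
p618869). [cite: SerreLocalFields1979, Ch. X §1 and VII.§6] [cite: SilvermanAEC2009, III.§7] -/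
theorem natCard_eq_sq_natCard_comap_resOfLe (hss : Rank1Residual.GoodSS W 2) (hΔ : W.Δ < 0) (κ : ZpExtension ℚ 2)
    (N : Subgroup (absoluteGaloisGroup ℚ)) [N.Normal] (hN : ∀ σ, σ ∈ N ↔ Perm.sign (permGal W h2 σ) = 1)
    (hNo : IsOpen (N : Set (absoluteGaloisGroup ℚ)))
    (w : InfinitePlace ℚ) {τ : absoluteGaloisGroup w.Completion} (hτ : τ ≠ 1)
    {τ₀ : absoluteGaloisGroup ℚ} (hτ₀ : Perm.sign (permGal W h2 τ₀) = 1) (hτ₀1 : permGal W h2 τ₀ ≠ 1)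
    (X : AddSubgroup (subgroupH1 (κ.kerSubgroup ⊓ N) ↥((↥(W.geomPrimaryTorsion 2))[(2 : ℤ)])))
    (hXω : ∀ x ∈ X, resH1Hom (ContinuousMonoidHom.id ↥(κ.kerSubgroup ⊓ N))
        (DistribSMul.toAddMonoidHom ↥((↥(W.geomPrimaryTorsion 2))[(2 : ℤ)]) τ₀)
        (endo_compat (κ.kerSubgroup ⊓ N) (DistribSMul.toAddMonoidHom _ τ₀)
          (fun a m ↦ by
            change τ₀ • (a : absoluteGaloisGroup ℚ) • m = (a : absoluteGaloisGroup ℚ) • τ₀ • m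
            exact smul_comm_of_even_primary W h2 hτ₀ ((hN _).1 (Subgroup.mem_inf.mp a.2).2) m)) x ∈ X)
    (hXc : ∀ x ∈ X, conjH1 (κ.kerSubgroup ⊓ N) ↥((↥(W.geomPrimaryTorsion 2))[(2 : ℤ)]) (resGal (K := ℚ) w.Completion τ) x ∈ X) :
    Nat.card X =
      Nat.card (X.comap (resOfLe ↥((↥(W.geomPrimaryTorsion 2))[(2 : ℤ)]) (inf_le_left : κ.kerSubgroup ⊓ N ≤ κ.kerSubgroup))) ^ 2 := by
  set c := resGal (K := ℚ) w.Completion τ with hc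
  set V := ↥((↥(W.geomPrimaryTorsion 2))[(2 : ℤ)]) with hV
  set res := resOfLe V (inf_le_left : κ.kerSubgroup ⊓ N ≤ κ.kerSubgroup) with hres
  have hcodd : Perm.sign (permGal W h2 c) = -1 := sign_permGal_resGal_eq_neg_one_of_Δ_neg W h2 hΔ w hτ
  have hcκ : c ∈ κ.kerSubgroup := ZpExtension.resGal_mem_kerSubgroup_of_infinitePlace κ w τ
  -- Step 1: `#X = (#X^{conj_c})²`
  have h1 := natCard_eq_sq_natCard_fixed_of_stable (κ.kerSubgroup ⊓ N) (DistribSMul.toAddMonoidHom V τ₀)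
    (fun a m ↦ by
      change τ₀ • (a : absoluteGaloisGroup ℚ) • m = (a : absoluteGaloisGroup ℚ) • τ₀ • m
      exact smul_comm_of_even_primary W h2 hτ₀ ((hN _).1 (Subgroup.mem_inf.mp a.2).2) m)
    (fun m ↦ by have := AddSubgroup.torsionBy.nsmul m; rwa [two_nsmul] at this ⊢)
    (fun m ↦ smul_smul_add_of_even_ne_one_primary W h2 hτ₀ hτ₀1 m)
    (σ := c) (by rw [hc, resGal_mul_self_eq_one]; exact one_mem _)
    (fun m ↦ odd_smul_even_primary W h2 hcodd hτ₀ hτ₀1 m) X hXω hXc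
  rw [h1]
  congr 1
  -- Step 2: `res⁻¹(X) ≃ X^{conj_c}`
  symm
  refine Nat.card_congr (Equiv.ofBijective
    (fun x : ↥(X.comap res) ↦ (⟨⟨res x, x.2⟩, ?_⟩ : {x : X // conjH1 (κ.kerSubgroup ⊓ N) V c (x : subgroupH1 _ V) = x}))
    ⟨fun x x' hxx' ↦ ?_, fun y ↦ ?_⟩)
  · -- invariance of restricted classes
    exact conjH1_resOfLe_kerSubgroup_inf_eq W κ N ⟨c, hcκ⟩ x
  · -- injectivity
    apply Subtype.ext
    exact resOfLe_kerSubgroup_inf_injective W hss κ N (index_eq_two_of_Δ_neg W h2 N hN hΔ)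
      (congrArg (fun z ↦ ((z.1 : X) : subgroupH1 (κ.kerSubgroup ⊓ N) V)) hxx')
  · -- surjectivity onto the fixed classes
    obtain ⟨⟨y, hyX⟩, hyc⟩ := y
    have hy' : ∀ g : κ.kerSubgroup, conjH1 (κ.kerSubgroup ⊓ N) V (g : absoluteGaloisGroup ℚ) y = y :=
      forall_conjH1_eq_of_conjH1_resGal_eq W h2 hΔ κ N hN w hτ hyc
    obtain ⟨x, hx⟩ := exists_resOfLe_kerSubgroup_inf_eq_of_forall_conjH1_eq W hss κ N
      (index_eq_two_of_Δ_neg W h2 N hN hΔ) hNo hy'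
    refine ⟨⟨x, ?_⟩, ?_⟩
    · change res x ∈ X
      rw [hres, hx]; exact hyX
    · apply Subtype.ext; apply Subtype.ext
      exact hx

end Summit.BirchSwinnertonDyer.BirchSwinnertonDyer.Theorems.ResidualLayer

end
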